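import Mathlib.Combinatorics.SetFamily.LYM
import Mathlib.Combinatorics.Enumerative.DoubleCounting
import Mathlib.Order.UpperLower.Basic
import Mathlib.Tactic.Linarith
import Mathlib.Tactic.Ring
import Mathlib.Tactic.NormNum

/-!
# `NoHeavyLowerTail` (crux stmt-CriticalPhenomena-4575), lane prim-ineq-gen-4 (gen 31): the single-coordinate lemma AT EVERY LEVEL

Support file (`--supports stmt-CriticalPhenomena-4575`; memo `run/shared/lean/prim/prim-ineq-gen-4/FINDING-PRINCIPAL-AND-CROSS-SPERNER-g31.md` §1.1).
Pure finite combinatorics, no definitions, no `sorry`, standard axioms.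

CONTEXT.  Gen 29/30 reduced every diagonal anti-band cell `(AB_m)(2m)` to the single-level Harris-type inequality
`Cov(f,g) ≥ P(#x = m)·Cov(f,g | #x = m)` on `{0,1}^{2m}` (bridge `AntiBandLevelHarrisBridge.antiBand_of_bandHarris`) and proved its sharp rank-one facet
`I_i(1_B) ≥ 2·P(#x=m)·d_i(1_B)` at the middle level (`AntiBandVerticalBias.two_mul_card_mid_mem_le`, via mirror inequalities of the odd sections).
Gen 31's principal-filter theorem (memo §1.2: `Cov(1_{↑z}, 1_B) ≥ 2·P(#x=m)·Cov_m(1_{↑z},1_B)` for every `z`, all `m`) telescopes conditional pivotalities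
inside the subcubes above `z`, whose middle is NOT the middle of the subcube; it therefore needs the single-coordinate lemma at an ARBITRARY level `j` of
an arbitrary cube `{0,1}^N`:

**THEOREM (`choose_mul_card_level_mem_le`).**  For an up-set `B` of subsets of an `N`-set, a point `i`, and `1 ≤ j`, with
`P_j = #{y ∈ B : #y = j, i ∈ y}`, `N_j = #{y ∈ B : #y = j, i ∉ y}`, `piv_i = #{x : i ∉ x, x ∉ B, insert i x ∈ B}`, `a = C(N−1, j−1)`, `b = C(N−1, j)`:
      `C(N, j) · P_j · b ≤ piv_i · a · b + C(N, j) · N_j · a`,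
i.e. `piv_i ≥ C(N,j)·(P_j / a − N_j / b)` — in probabilistic terms `I_i(1_B) ≥ (q_{j−1} + q_j)·d_i^{(j)}(1_B)` with `q_ℓ = C(N−1,ℓ)/2^{N−1}` and
`d_i^{(j)}` the slice influence at level `j`.  At `N = 2m`, `j = m` (`a = b`) it is the gen-30 lemma `2(P_m − N_m) ≤ piv_i`.
PROOF.  The two sections `B⁰ = {y ∈ B : i ∉ y}` and `B¹ = {y ∖ i : y ∈ B, i ∈ y}` are up-closed inside the ground set `univ.erase i` (size `N − 1`),
so their level densities are non-decreasing (normalized matching, `card_level_mul_choose_le`, a double count of the covering edges):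
`N_{j−1}·b ≤ N_j·a` and `P_j·b ≤ P_{j+1}·a`; the pivotal `i`-edges between levels `j−1, j` and `j, j+1` number at least `(P_j − N_{j−1}) + (P_{j+1} − N_j)`
(`x ↦ insert i x`); combine with Pascal's rule `C(N,j) = a + b`.
-/

namespace Summit.CriticalPhenomena.PercolationContinuityZ3.Theorems.AntiBandLevelSCL

open Finset

variable {α : Type*} [DecidableEq α]

/-! ### Normalized matching inside a ground finset -/

/-- **Normalized matching (counting form).**  If `U ⊆ 𝒫(t)` is closed under adding points of `t`, then `#U_r · (#t − r) ≤ #U_{r+1} · (r + 1)`: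
double count the covering pairs `x ⊂ y` between consecutive levels. [folklore] -/
theorem card_level_mul_le (t : Finset α) (U : Finset (Finset α)) (hUt : ∀ x ∈ U, x ⊆ t)
    (hU : ∀ x ∈ U, ∀ a ∈ t, insert a x ∈ U) (r : ℕ) :
    #(U.filter fun x => #x = r) * (#t - r) ≤ #(U.filter fun x => #x = r + 1) * (r + 1) := by
  refine Finset.card_mul_le_card_mul (fun x y => x ⊆ y) ?_ ?_
  · intro x hx
    rw [mem_filter] at hx
    obtain ⟨hxU, hxr⟩ := hx
    have hinj : Set.InjOn (fun a => insert a x) ↑(t \ x) := by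
      intro a ha a' ha' h
      rw [mem_coe, mem_sdiff] at ha ha'
      have h' : a ∈ insert a' x := by
        have : a ∈ insert a x := mem_insert_self a x
        simp only at h
        rwa [h] at this
      rcases mem_insert.1 h' with h1 | h1
      · exact h1
      · exact absurd h1 ha.2
    calc #t - r = #(t \ x) := by rw [card_sdiff_of_subset (hUt x hxU), hxr]
      _ = #((t \ x).image fun a => insert a x) := (card_image_of_injOn hinj).symm
      _ ≤ #((U.filter fun y => #y = r + 1).bipartiteAbove (fun x y => x ⊆ y) x) := by
          apply card_le_card
          intro y hy
          rw [mem_image] at hy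
          obtain ⟨a, ha, rfl⟩ := hy
          rw [mem_sdiff] at ha
          rw [mem_bipartiteAbove, mem_filter]
          exact ⟨⟨hU x hxU a ha.1, by rw [card_insert_of_notMem ha.2, hxr]⟩, subset_insert a x⟩
  · intro y hy
    rw [mem_filter] at hy
    obtain ⟨_, hyr⟩ := hy
    calc #((U.filter fun x => #x = r).bipartiteBelow (fun x y => x ⊆ y) y)
        ≤ #(y.image fun a => y.erase a) := by
          apply card_le_card
          intro x hx
          rw [mem_bipartiteBelow, mem_filter] at hx
          obtain ⟨⟨_, hxr⟩, hxy⟩ := hx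
          have hcard : #(y \ x) = 1 := by rw [card_sdiff_of_subset hxy, hyr, hxr]; omega
          obtain ⟨a, ha⟩ := card_eq_one.1 hcard
          have hay : a ∈ y \ x := by rw [ha]; exact mem_singleton_self a
          rw [mem_image]
          refine ⟨a, (mem_sdiff.1 hay).1, ?_⟩
          ext b
          rw [mem_erase]
          constructor
          · rintro ⟨hba, hby⟩
            by_contra hbx
            have hb : b ∈ y \ x := mem_sdiff.2 ⟨hby, hbx⟩
            rw [ha, mem_singleton] at hb
            exact hba hb
          · intro hbx
            refine ⟨?_, hxy hbx⟩
            rintro rfl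
            exact (mem_sdiff.1 hay).2 hbx
      _ ≤ #y := card_image_le
      _ = r + 1 := hyr

/-- **Normalized matching (binomial form).**  For `U ⊆ 𝒫(t)` closed under adding points of `t`:
`#U_r · C(#t, r+1) ≤ #U_{r+1} · C(#t, r)`, i.e. the level densities `#U_r / C(#t, r)` are non-decreasing in `r`. [folklore] -/
theorem card_level_mul_choose_le (t : Finset α) (U : Finset (Finset α)) (hUt : ∀ x ∈ U, x ⊆ t)
    (hU : ∀ x ∈ U, ∀ a ∈ t, insert a x ∈ U) (r : ℕ) :
    #(U.filter fun x => #x = r) * (#t).choose (r + 1) ≤ #(U.filter fun x => #x = r + 1) * (#t).choose r := by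
  have h := card_level_mul_le t U hUt hU r
  have hc : (#t).choose (r + 1) * (r + 1) = (#t).choose r * (#t - r) := Nat.choose_succ_right_eq (#t) r
  have key : #(U.filter fun x => #x = r) * (#t).choose (r + 1) * (r + 1)
      ≤ #(U.filter fun x => #x = r + 1) * (#t).choose r * (r + 1) := by
    calc #(U.filter fun x => #x = r) * (#t).choose (r + 1) * (r + 1)
        = #(U.filter fun x => #x = r) * (#t - r) * (#t).choose r := by rw [mul_assoc, hc]; ring
      _ ≤ #(U.filter fun x => #x = r + 1) * (r + 1) * (#t).choose r := Nat.mul_le_mul_right _ h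
      _ = #(U.filter fun x => #x = r + 1) * (#t).choose r * (r + 1) := by ring
  exact Nat.le_of_mul_le_mul_right key (Nat.succ_pos r)

/-! ### The two sections of an up-set -/

variable [Fintype α]

/-- The `i ∉ y` section of an up-set is closed under adding points other than `i`. [folklore] -/
theorem section_zero_insert (B : Finset (Finset α)) (hB : IsUpperSet (B : Set (Finset α))) (i : α) :
    ∀ x ∈ B.filter (fun y => i ∉ y), ∀ a ∈ univ.erase i, insert a x ∈ B.filter (fun y => i ∉ y) := by
  intro x hx a ha
  rw [mem_filter] at hx ⊢
  rw [mem_erase] at ha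
  refine ⟨hB (subset_insert a x) hx.1, ?_⟩
  rw [mem_insert]
  rintro (h | h)
  · exact ha.1 h.symm
  · exact hx.2 h

/-- The members of the `i ∉ y` section avoid `i`. [folklore] -/
theorem section_zero_subset (B : Finset (Finset α)) (i : α) :
    ∀ x ∈ B.filter (fun y => i ∉ y), x ⊆ univ.erase i := by
  intro x hx b hb
  rw [mem_erase]
  exact ⟨fun h => (mem_filter.1 hx).2 (h ▸ hb), mem_univ b⟩

/-- The `i ∈ y` section (with `i` erased) of an up-set is closed under adding points other than `i`. [folklore] -/
theorem section_one_insert (B : Finset (Finset α)) (hB : IsUpperSet (B : Set (Finset α))) (i : α) :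
    ∀ x ∈ (B.filter (fun y => i ∈ y)).image (fun y => y.erase i), ∀ a ∈ univ.erase i,
      insert a x ∈ (B.filter (fun y => i ∈ y)).image (fun y => y.erase i) := by
  intro x hx a ha
  rw [mem_image] at hx ⊢
  obtain ⟨y, hy, rfl⟩ := hx
  rw [mem_filter] at hy
  rw [mem_erase] at ha
  refine ⟨insert a y, mem_filter.2 ⟨hB (subset_insert a y) hy.1, mem_insert_of_mem hy.2⟩, ?_⟩
  exact erase_insert_of_ne ha.1

/-- The members of the erased `i ∈ y` section avoid `i`. [folklore] -/
theorem section_one_subset (B : Finset (Finset α)) (i : α) :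
    ∀ x ∈ (B.filter (fun y => i ∈ y)).image (fun y => y.erase i), x ⊆ univ.erase i := by
  intro x hx
  rw [mem_image] at hx
  obtain ⟨y, _, rfl⟩ := hx
  intro b hb
  rw [mem_erase] at hb ⊢
  exact ⟨hb.1, mem_univ b⟩

omit [Fintype α] in
/-- Level counts of the `i ∉ y` section. [folklore] -/
theorem card_section_zero_level (B : Finset (Finset α)) (i : α) (l : ℕ) :
    #((B.filter (fun y => i ∉ y)).filter fun x => #x = l) = #(B.filter fun y => #y = l ∧ i ∉ y) := by
  rw [filter_filter]
  exact congrArg card (filter_congr fun x _ => by tauto)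

omit [Fintype α] in
/-- Level counts of the erased `i ∈ y` section: level `l` there is level `l+1` of `B`. [folklore] -/
theorem card_section_one_level (B : Finset (Finset α)) (i : α) (l : ℕ) :
    #(((B.filter (fun y => i ∈ y)).image (fun y => y.erase i)).filter fun x => #x = l)
      = #(B.filter fun y => #y = l + 1 ∧ i ∈ y) := by
  have hinj : Set.InjOn (fun y : Finset α => y.erase i) ↑(B.filter fun y => i ∈ y) := by
    intro y hy y' hy' h
    have hyi := (mem_filter.1 hy).2
    have hy'i := (mem_filter.1 hy').2
    simp only at h
    rw [← insert_erase hyi, ← insert_erase hy'i, h]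
  rw [filter_image, card_image_of_injOn (fun y hy y' hy' h => hinj (mem_filter.1 hy).1 (mem_filter.1 hy').1 h), filter_filter]
  refine congrArg card (filter_congr fun y _ => ?_)
  constructor
  · rintro ⟨hyi, h⟩
    refine ⟨?_, hyi⟩
    rw [card_erase_of_mem hyi] at h
    have := card_pos.2 ⟨i, hyi⟩
    omega
  · rintro ⟨h, hyi⟩
    refine ⟨hyi, ?_⟩
    rw [card_erase_of_mem hyi, h]
    rfl

/-! ### The single-coordinate lemma at level `j` -/

/-- **Single-coordinate lemma at every level.**  For an up-set `B` of subsets of an `N`-set, a point `i` and `1 ≤ j`, with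
`a = C(N−1, j−1)`, `b = C(N−1, j)`:  `C(N,j)·#{y ∈ B | #y = j ∧ i ∈ y}·b ≤ #{x | i ∉ x ∧ x ∉ B ∧ insert i x ∈ B}·a·b + C(N,j)·#{y ∈ B | #y = j ∧ i ∉ y}·a`
(`piv_i(B) ≥ C(N,j)·(P_j/C(N−1,j−1) − N_j/C(N−1,j))`; the influence of `i` dominates `(q_{j−1}+q_j)` times the slice influence of `i` at level `j`).
At `N = 2m, j = m` this is `AntiBandVerticalBias.two_mul_card_mid_mem_le`. [this work; memo g31 §1.1] -/
theorem choose_mul_card_level_mem_le (N : ℕ) (hα : Fintype.card α = N) (B : Finset (Finset α))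
    (hB : IsUpperSet (B : Set (Finset α))) (i : α) (j : ℕ) (hj : 1 ≤ j) :
    N.choose j * #(B.filter fun y => #y = j ∧ i ∈ y) * (N - 1).choose j
      ≤ #((univ : Finset (Finset α)).filter fun x => i ∉ x ∧ x ∉ B ∧ insert i x ∈ B) * (N - 1).choose (j - 1) * (N - 1).choose j
        + N.choose j * #(B.filter fun y => #y = j ∧ i ∉ y) * (N - 1).choose (j - 1) := by
  -- counts
  set P : ℕ → ℕ := fun l => #(B.filter fun y => #y = l ∧ i ∈ y) with hPdef
  set Nn : ℕ → ℕ := fun l => #(B.filter fun y => #y = l ∧ i ∉ y) with hNdef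
  set piv := #((univ : Finset (Finset α)).filter fun x => i ∉ x ∧ x ∉ B ∧ insert i x ∈ B) with hpivdef
  set a := (N - 1).choose (j - 1) with hadef
  set b := (N - 1).choose j with hbdef
  have ht : #(univ.erase i : Finset α) = N - 1 := by rw [card_erase_of_mem (mem_univ i), card_univ, hα]
  have hN1 : 1 ≤ N := by rw [← hα]; exact Fintype.card_pos_iff.2 ⟨i⟩
  -- Pascal
  have hpascal : N.choose j = a + b := by
    rw [hadef, hbdef]
    obtain ⟨N', hN'⟩ : ∃ N', N = N' + 1 := ⟨N - 1, by omega⟩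
    obtain ⟨j', hj'⟩ : ∃ j', j = j' + 1 := ⟨j - 1, by omega⟩
    subst hN' hj'
    rw [Nat.choose_succ_succ', Nat.add_sub_cancel, Nat.add_sub_cancel]
  -- density monotonicity of the two sections between levels `j-1` and `j`
  have hmono0 : Nn (j - 1) * b ≤ Nn j * a := by
    have h := card_level_mul_choose_le (univ.erase i) (B.filter fun y => i ∉ y) (section_zero_subset B i)
      (section_zero_insert B hB i) (j - 1)
    rw [ht, card_section_zero_level, card_section_zero_level, show j - 1 + 1 = j by omega] at h
    exact h
  have hmono1 : P j * b ≤ P (j + 1) * a := by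
    have h := card_level_mul_choose_le (univ.erase i) ((B.filter fun y => i ∈ y).image fun y => y.erase i)
      (section_one_subset B i) (section_one_insert B hB i) (j - 1)
    rw [ht, card_section_one_level, card_section_one_level, show j - 1 + 1 = j by omega] at h
    exact h
  -- pivotal edges from level `l` to `l+1`: at least `P (l+1) - N l`, via the injection `y ↦ y.erase i`
  have hpiv : ∀ l : ℕ, P (l + 1) ≤ Nn l
      + #((univ : Finset (Finset α)).filter fun x => (i ∉ x ∧ x ∉ B ∧ insert i x ∈ B) ∧ #x = l) := by
    intro l
    have hinj : Set.InjOn (fun y : Finset α => y.erase i) ↑(B.filter fun y => #y = l + 1 ∧ i ∈ y) := by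
      intro y hy y' hy' h
      have hyi := (mem_filter.1 hy).2.2
      have hy'i := (mem_filter.1 hy').2.2
      simp only at h
      rw [← insert_erase hyi, ← insert_erase hy'i, h]
    have himg : (B.filter fun y => #y = l + 1 ∧ i ∈ y).image (fun y => y.erase i)
        ⊆ (B.filter fun x => #x = l ∧ i ∉ x) ∪
          ((univ : Finset (Finset α)).filter fun x => (i ∉ x ∧ x ∉ B ∧ insert i x ∈ B) ∧ #x = l) := by
      intro x hx
      rw [mem_image] at hx
      obtain ⟨y, hy, rfl⟩ := hx
      rw [mem_filter] at hy
      obtain ⟨hyB, hyl, hyi⟩ := hy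
      have hcard : #(y.erase i) = l := by rw [card_erase_of_mem hyi, hyl]; rfl
      have hins : insert i (y.erase i) ∈ B := by rw [insert_erase hyi]; exact hyB
      by_cases hxB : y.erase i ∈ B
      · exact mem_union_left _ (mem_filter.2 ⟨hxB, hcard, notMem_erase i y⟩)
      · exact mem_union_right _ (mem_filter.2 ⟨mem_univ _, ⟨notMem_erase i y, hxB, hins⟩, hcard⟩)
    calc P (l + 1) = #((B.filter fun y => #y = l + 1 ∧ i ∈ y).image fun y => y.erase i) :=
          (card_image_of_injOn hinj).symm
      _ ≤ #((B.filter fun x => #x = l ∧ i ∉ x) ∪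
          ((univ : Finset (Finset α)).filter fun x => (i ∉ x ∧ x ∉ B ∧ insert i x ∈ B) ∧ #x = l)) := card_le_card himg
      _ ≤ Nn l + #((univ : Finset (Finset α)).filter fun x => (i ∉ x ∧ x ∉ B ∧ insert i x ∈ B) ∧ #x = l) :=
          card_union_le _ _
  -- the two pivotal layers `j-1 → j` and `j → j+1` are disjoint parts of the pivotal set
  have hsum : #((univ : Finset (Finset α)).filter fun x => (i ∉ x ∧ x ∉ B ∧ insert i x ∈ B) ∧ #x = j - 1)
      + #((univ : Finset (Finset α)).filter fun x => (i ∉ x ∧ x ∉ B ∧ insert i x ∈ B) ∧ #x = j) ≤ piv := by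
    have hdisj : Disjoint ((univ : Finset (Finset α)).filter fun x => (i ∉ x ∧ x ∉ B ∧ insert i x ∈ B) ∧ #x = j - 1)
        ((univ : Finset (Finset α)).filter fun x => (i ∉ x ∧ x ∉ B ∧ insert i x ∈ B) ∧ #x = j) := by
      rw [disjoint_filter]
      intro x _ h1 h2
      omega
    rw [← card_union_of_disjoint hdisj]
    refine card_le_card (union_subset ?_ ?_) <;>
      · intro x hx
        rw [mem_filter] at hx ⊢
        exact ⟨hx.1, hx.2.1⟩
  have h1 := hpiv (j - 1)
  rw [show j - 1 + 1 = j by omega] at h1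
  have h2 := hpiv j
  -- `P j + P (j+1) ≤ piv + N (j-1) + N j`
  have h3 : P j + P (j + 1) ≤ piv + Nn (j - 1) + Nn j := by omega
  -- combine: `(a+b) P_j b ≤ piv a b + (a+b) N_j a`
  have e1 := Nat.mul_le_mul_right a hmono0      -- N_{j-1} b a ≤ N_j a a
  have e2 := Nat.mul_le_mul_right b hmono1      -- P_j b b ≤ P_{j+1} a b
  have e3 := Nat.mul_le_mul_right (a * b) h3  -- (P_j + P_{j+1}) a b ≤ (piv + N_{j-1} + N_j) a b
  show N.choose j * P j * b ≤ piv * a * b + N.choose j * Nn j * a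
  rw [hpascal]
  nlinarith [e1, e2, e3]

end Summit.CriticalPhenomena.PercolationContinuityZ3.Theorems.AntiBandLevelSCL
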